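/-
Copyright (c) 2026 the pub-hodgecm-mathlib formalisation cell (harness21).  Prover seat hodgecm-mathlib-LH4-p12 (g0), Track A «FOUR-FRAME», unit U2H_HSide, dictionary
first seat after LH4-p13 (g0)'s close («ED. 2» of ★ p855546 = this rider, LH4-p13 23:22:56Z).  2026-09-03.
-/
import Literature.NumberTheory.Automorphic.SLTwoTreeQuadraticTorusNormalForm        -- ★ p855546 (LH4-p13): (N1) normal form, (N2) deep ⟹ vertex, (N3), §3 packages
import HarnessLib

/-!
# The torus normal form of an elliptic element of `GL₂(F)` — the SHARP depth hypothesis for an Eisenstein datum (rider to ★ `SLTwoTreeQuadraticTorusNormalForm`)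

★ `valuation_two_mul_le_valuation_sub_of_deep` (N2) derives `|2z| ≤ |t − zu|` (so that `b = 2z∕(t − zu) ∈ 𝒪`, the torus form `(1, bv; b, 1 + bu)` is integral)
from the DEEP hypothesis `|t² − 4d| < |u² + 4v|·|t|²`.  That hypothesis is sufficient but not necessary: with `x = (t − zu)∕2` it reads `|z| < |2x + zu|`, i.e.
`|b| < |2|`, and at a dyadic place it excludes every vertex-type element with `v(b) ≤ v(2)` — for the census of the D-RAM four-frame road exactly the threshold
rows (`n₃ ∈ {d, d + 2}` at `(d, t) ∈ {(3, 2), (2, 2)}`).  For an EISENSTEIN datum (`|u| < 1`, `|v| = |ϖ|`, `ϖ` a uniformiser) this file proves the sharp form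

  **(N2′) `|t² − 4d| ≤ |u² + 4v|·|d| ⟹ |2z| ≤ |t − zu|`**, and conversely (`…_iff_…`): the hypothesis is EQUIVALENT to vertex type,

scale-invariant in `g ↦ c·g` (`|disc| ∕ |det|` instead of `|disc| ∕ |tr|²`); in eigenvalue currency `|disc|∕|det| = |e₁∕e₂ − 1|²` and `|u² + 4v| = |τ − στ|² = |ϖ_E|^{2d}`,
so (N2′) is «row depth `≥ d`» (★ `F0P3cDyRamTypeOneDepthLaw.valuation_le_iff_valuation_div_map_sub_one_le` is the same statement in `E`-tokens).  PROOF: were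
`|t − zu| < |2z|`, discreteness gives `|t − zu| ≤ |ϖ|·|2z|`, and in `4d = (t − zu)² + 2zu(t − zu) − 4vz²` the last term dominates strictly (`|ϖ|² < |ϖ| = |v|`,
`|u| < 1`): `|4d| = |4vz²| = |2z|²|ϖ|`, whence `|u² + 4v|·|d|·|4| = |u² + 4v||2z|²|ϖ| < |u² + 4v||2z|² = |4(t² − 4d)|`, contradicting (N2′)·|4|.
Then the §3 package of ★ p855546 with `hdeep'` in place of `hdeep` (`exists_torusForm_binders_of_eisenstein_of_deep'`), which is what the U2H (b′) assembler binds.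

## References
* [LabesseLanglands1979] J.-P. Labesse, R. P. Langlands, *L-indistinguishability for SL(2)*, Canad. J. Math. 31 (1979), §2 pp. 7–8 (the torus `(a, bv; b, a + bu)`,
  its conductor and fixed ball).
* [Serre1980Trees] J.-P. Serre, *Trees*, Ch. II §1.3 (vertex vs. edge type of an automorphism of the tree of `SL₂`).
* [Serre1979] J.-P. Serre, *Local Fields*, GTM 67, Ch. I §6 (Eisenstein equations), Ch. I §1 (discrete valuations).
-/

set_option autoImplicit false

noncomputable section

open scoped ValuativeRel Matrix MatrixGroups
open Matrix ValuativeRel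

namespace Literature.NumberTheory.Automorphic.HermitianLatticeTree

open Literature.NumberTheory.Automorphic Literature.NumberTheory.LocalFields

section Valuation

variable {F : Type*} [Field F] [ValuativeRel F]

/-- DISCRETENESS: `|x| < |y|`, `y ≠ 0` ⟹ `|x| ≤ |ϖ|·|y|` for a uniformiser `ϖ`. [cite: Serre1979, Ch. I §1] -/
theorem valuation_le_valuation_mul_of_lt {ϖ : F} (hϖ : IsUniformizingElement ϖ) {x y : F} (hy : y ≠ 0)
    (h : valuation F x < valuation F y) : valuation F x ≤ valuation F ϖ * valuation F y := by
  have hq : valuation F (x / y) < 1 := by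
    rw [Valuation.map_div]
    exact (div_lt_one₀ ((Valuation.pos_iff _).2 hy)).2 h
  obtain ⟨w, hw, hweq⟩ := hϖ.exists_eq_mul ((Valuation.mem_integer_iff _ _).2 hq.le) hq
  have hx : x = ϖ * w * y := by
    have hc := div_mul_cancel₀ x hy
    rw [hweq] at hc
    exact hc.symm
  rw [hx, Valuation.map_mul, Valuation.map_mul]
  calc valuation F ϖ * valuation F w * valuation F y ≤ valuation F ϖ * 1 * valuation F y :=
        mul_le_mul' (mul_le_mul' le_rfl ((Valuation.mem_integer_iff _ _).1 hw)) le_rfl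
    _ = valuation F ϖ * valuation F y := by rw [mul_one]

omit [ValuativeRel F] in
/-- `4d = (t − zu)² + 2zu·(t − zu) − 4v·z²` when `t² − 4d = (u² + 4v)·z²`. [cite: LabesseLanglands1979, §2 p. 7] -/
theorem four_mul_det_eq {t d u v z : F} (hD : t ^ 2 - 4 * d = (u ^ 2 + 4 * v) * z ^ 2) :
    4 * d = (t - z * u) ^ 2 + 2 * z * u * (t - z * u) - 4 * v * z ^ 2 := by
  linear_combination -hD

/-- EDGE TYPE HAS `|4d| = |2z|²·|ϖ|` (Eisenstein datum): if `|t − zu| < |2z|` then `|4d| = |4vz²| = |2z|²·|ϖ|` — the element is conjugate to `τ·(unit)` up to `F^×`,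
its determinant class is `ϖ·(squares·units)`: it reverses the vertex types of the tree. [cite: LabesseLanglands1979, §2 p. 8] [cite: Serre1980Trees, Ch. II §1.3] -/
theorem valuation_four_mul_det_of_lt (h2 : (2 : F) ≠ 0) {ϖ : F} (hϖ : IsUniformizingElement ϖ) {t d u v z : F} (hz : z ≠ 0)
    (hD : t ^ 2 - 4 * d = (u ^ 2 + 4 * v) * z ^ 2) (hu1 : valuation F u < 1) (hv1 : valuation F v = valuation F ϖ)
    (hlt : valuation F (t - z * u) < valuation F (2 * z)) :
    valuation F (4 * d) = valuation F (2 * z) ^ 2 * valuation F ϖ := by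
  set X := t - z * u with hX
  have h2z : (2 : F) * z ≠ 0 := mul_ne_zero h2 hz
  have hv2z : 0 < valuation F (2 * z) := (Valuation.pos_iff _).2 h2z
  have hvϖ : 0 < valuation F ϖ := (Valuation.pos_iff _).2 hϖ.ne_zero
  have hXle : valuation F X ≤ valuation F ϖ * valuation F (2 * z) := valuation_le_valuation_mul_of_lt hϖ h2z hlt
  have hvz : valuation F (4 * v * z ^ 2) = valuation F (2 * z) ^ 2 * valuation F ϖ := by
    rw [show (4 : F) * v * z ^ 2 = (2 * z) ^ 2 * v by ring, Valuation.map_mul, Valuation.map_pow, hv1]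
  have hA : 0 < valuation F (2 * z) ^ 2 * valuation F ϖ := mul_pos (pow_pos hv2z 2) hvϖ
  -- `|X²| < |4vz²|`
  have hX2 : valuation F (X ^ 2) < valuation F (4 * v * z ^ 2) := by
    rw [Valuation.map_pow, hvz]
    calc valuation F X ^ 2 ≤ (valuation F ϖ * valuation F (2 * z)) ^ 2 := pow_le_pow_left' hXle 2
      _ = valuation F ϖ * (valuation F (2 * z) ^ 2 * valuation F ϖ) := by simp only [sq]; ac_rfl
      _ < 1 * (valuation F (2 * z) ^ 2 * valuation F ϖ) := mul_lt_mul_of_pos_right hϖ.valuation_lt_one hA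
      _ = valuation F (2 * z) ^ 2 * valuation F ϖ := one_mul _
  -- `|2zu·X| < |4vz²|`
  have hzuX : valuation F (2 * z * u * X) < valuation F (4 * v * z ^ 2) := by
    rw [hvz, show (2 : F) * z * u * X = u * (X * (2 * z)) by ring, Valuation.map_mul, Valuation.map_mul]
    calc valuation F u * (valuation F X * valuation F (2 * z)) ≤ valuation F u * (valuation F ϖ * valuation F (2 * z) * valuation F (2 * z)) :=
          mul_le_mul' le_rfl (mul_le_mul' hXle le_rfl)
      _ = valuation F u * (valuation F (2 * z) ^ 2 * valuation F ϖ) := by simp only [sq]; ac_rfl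
      _ < 1 * (valuation F (2 * z) ^ 2 * valuation F ϖ) := mul_lt_mul_of_pos_right hu1 hA
      _ = valuation F (2 * z) ^ 2 * valuation F ϖ := one_mul _
  -- hence `|4d| = |4vz²|`
  rw [four_mul_det_eq hD, ← hX, show X ^ 2 + 2 * z * u * X - 4 * v * z ^ 2 = (X ^ 2 + 2 * z * u * X) + -(4 * v * z ^ 2) by ring,
    Valuation.map_add_eq_of_lt_right, Valuation.map_neg, hvz]
  rw [Valuation.map_neg]
  exact lt_of_le_of_lt (Valuation.map_add _ _ _) (max_lt hX2 hzuX)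

/-- VERTEX TYPE HAS `|4d| = |t − zu|²` (Eisenstein datum): if `|2z| ≤ |t − zu|` and `z ≠ 0` then `|4d| = |t − zu|²` (`= |2x|²`). [cite: LabesseLanglands1979, §2 p. 8] -/
theorem valuation_four_mul_det_of_le (h2 : (2 : F) ≠ 0) {ϖ : F} (hϖ : IsUniformizingElement ϖ) {t d u v z : F} (hz : z ≠ 0)
    (hD : t ^ 2 - 4 * d = (u ^ 2 + 4 * v) * z ^ 2) (hu1 : valuation F u < 1) (hv1 : valuation F v = valuation F ϖ)
    (hle : valuation F (2 * z) ≤ valuation F (t - z * u)) :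
    valuation F (4 * d) = valuation F (t - z * u) ^ 2 := by
  set X := t - z * u with hX
  have h2z : (2 : F) * z ≠ 0 := mul_ne_zero h2 hz
  have hv2z : 0 < valuation F (2 * z) := (Valuation.pos_iff _).2 h2z
  have hvX : 0 < valuation F X := lt_of_lt_of_le hv2z hle
  have hB : 0 < valuation F X ^ 2 := pow_pos hvX 2
  -- `|2zu·X| < |X|²`
  have hzuX : valuation F (2 * z * u * X) < valuation F (X ^ 2) := by
    rw [show (2 : F) * z * u * X = u * ((2 * z) * X) by ring, Valuation.map_mul, Valuation.map_mul, Valuation.map_pow]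
    calc valuation F u * (valuation F (2 * z) * valuation F X) ≤ valuation F u * (valuation F X * valuation F X) :=
          mul_le_mul' le_rfl (mul_le_mul' hle le_rfl)
      _ = valuation F u * valuation F X ^ 2 := by rw [sq]
      _ < 1 * valuation F X ^ 2 := mul_lt_mul_of_pos_right hu1 hB
      _ = valuation F X ^ 2 := one_mul _
  -- `|4vz²| < |X|²`
  have hvz : valuation F (4 * v * z ^ 2) < valuation F (X ^ 2) := by
    rw [show (4 : F) * v * z ^ 2 = v * (2 * z) ^ 2 by ring, Valuation.map_mul, Valuation.map_pow, Valuation.map_pow, hv1]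
    calc valuation F ϖ * valuation F (2 * z) ^ 2 ≤ valuation F ϖ * valuation F X ^ 2 := mul_le_mul' le_rfl (pow_le_pow_left' hle 2)
      _ < 1 * valuation F X ^ 2 := mul_lt_mul_of_pos_right hϖ.valuation_lt_one hB
      _ = valuation F X ^ 2 := one_mul _
  rw [four_mul_det_eq hD, ← hX, show X ^ 2 + 2 * z * u * X - 4 * v * z ^ 2 = X ^ 2 + (2 * z * u * X - 4 * v * z ^ 2) by ring,
    Valuation.map_add_eq_of_lt_left]
  · exact Valuation.map_pow _ _ _
  · exact lt_of_le_of_lt (Valuation.map_sub _ _ _) (max_lt hzuX hvz)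

/-- **SHARP DEEP ⟹ VERTEX TYPE (N2′), EISENSTEIN DATUM.**  For `t² − 4d = (u² + 4v)·z²` with `z ≠ 0`, `u² + 4v ≠ 0`, `|u| < 1`, `|v| = |ϖ|` (`ϖ` a uniformiser,
`char F ≠ 2`): **`|t² − 4d| ≤ |u² + 4v|·|d| ⟹ |2z| ≤ |t − zu|`** — so `b = 2z∕(t − zu) ∈ 𝒪` with NO dyadic loss (★ (N2) needs `|t² − 4d| < |u² + 4v|·|t|²`,
i.e. `|b| < |2|`).  The hypothesis is `|disc g| ≤ |disc τ|·|det g|`, invariant under `g ↦ c·g`. [cite: LabesseLanglands1979, §2 p. 8] [cite: Serre1980Trees, Ch. II §1.3] -/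
theorem valuation_two_mul_le_valuation_sub_of_deep' (h2 : (2 : F) ≠ 0) {ϖ : F} (hϖ : IsUniformizingElement ϖ) {t d u v z : F}
    (hz : z ≠ 0) (hdisc : u ^ 2 + 4 * v ≠ 0) (hD : t ^ 2 - 4 * d = (u ^ 2 + 4 * v) * z ^ 2)
    (hu1 : valuation F u < 1) (hv1 : valuation F v = valuation F ϖ)
    (hdeep' : valuation F (t ^ 2 - 4 * d) ≤ valuation F (u ^ 2 + 4 * v) * valuation F d) :
    valuation F (2 * z) ≤ valuation F (t - z * u) := by
  by_contra hlt
  rw [not_le] at hlt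
  have h4d := valuation_four_mul_det_of_lt h2 hϖ hz hD hu1 hv1 hlt
  have h2z : (2 : F) * z ≠ 0 := mul_ne_zero h2 hz
  have h4 : (4 : F) ≠ 0 := by rw [show (4 : F) = 2 * 2 by norm_num]; exact mul_ne_zero h2 h2
  -- multiply `hdeep'` by `|4|` and rewrite both sides
  have hA : 0 < valuation F (u ^ 2 + 4 * v) * valuation F (2 * z) ^ 2 :=
    mul_pos ((Valuation.pos_iff _).2 hdisc) (pow_pos ((Valuation.pos_iff _).2 h2z) 2)
  have hL : valuation F (4 : F) * valuation F (t ^ 2 - 4 * d) = valuation F (u ^ 2 + 4 * v) * valuation F (2 * z) ^ 2 := by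
    rw [← Valuation.map_mul, show (4 : F) * (t ^ 2 - 4 * d) = (u ^ 2 + 4 * v) * (2 * z) ^ 2 by rw [hD]; ring, Valuation.map_mul, Valuation.map_pow]
  have hR : valuation F (4 : F) * (valuation F (u ^ 2 + 4 * v) * valuation F d) = valuation F (u ^ 2 + 4 * v) * valuation F (2 * z) ^ 2 * valuation F ϖ := by
    rw [mul_left_comm, ← Valuation.map_mul, h4d, mul_assoc]
  have key : valuation F (u ^ 2 + 4 * v) * valuation F (2 * z) ^ 2 ≤ valuation F (u ^ 2 + 4 * v) * valuation F (2 * z) ^ 2 * valuation F ϖ := by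
    rw [← hR, ← hL]
    exact mul_le_mul' le_rfl hdeep'
  have hlt1 : valuation F (u ^ 2 + 4 * v) * valuation F (2 * z) ^ 2 * valuation F ϖ < valuation F (u ^ 2 + 4 * v) * valuation F (2 * z) ^ 2 * 1 :=
    mul_lt_mul_of_pos_left hϖ.valuation_lt_one hA
  rw [mul_one] at hlt1
  exact absurd (lt_of_le_of_lt key hlt1) (lt_irrefl _)

/-- **CONVERSE OF (N2′)**: vertex type (`|2z| ≤ |t − zu|`) implies `|t² − 4d| ≤ |u² + 4v|·|d|` — so (N2′) is an EQUIVALENCE (the hypothesis is sharp).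
[cite: LabesseLanglands1979, §2 p. 8] [cite: Serre1980Trees, Ch. II §1.3] -/
theorem valuation_sub_le_of_valuation_two_mul_le (h2 : (2 : F) ≠ 0) {ϖ : F} (hϖ : IsUniformizingElement ϖ) {t d u v z : F}
    (hz : z ≠ 0) (hD : t ^ 2 - 4 * d = (u ^ 2 + 4 * v) * z ^ 2) (hu1 : valuation F u < 1) (hv1 : valuation F v = valuation F ϖ)
    (hle : valuation F (2 * z) ≤ valuation F (t - z * u)) :
    valuation F (t ^ 2 - 4 * d) ≤ valuation F (u ^ 2 + 4 * v) * valuation F d := by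
  have h4d := valuation_four_mul_det_of_le h2 hϖ hz hD hu1 hv1 hle
  have h4 : (4 : F) ≠ 0 := by rw [show (4 : F) = 2 * 2 by norm_num]; exact mul_ne_zero h2 h2
  have hv4 : 0 < valuation F (4 : F) := (Valuation.pos_iff _).2 h4
  rw [← mul_le_mul_iff_right₀ hv4, ← Valuation.map_mul, show (4 : F) * (t ^ 2 - 4 * d) = (u ^ 2 + 4 * v) * (2 * z) ^ 2 by rw [hD]; ring,
    Valuation.map_mul, Valuation.map_pow, mul_left_comm, ← Valuation.map_mul, h4d]
  exact mul_le_mul' le_rfl (pow_le_pow_left' hle 2)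

/-- **(N2′) AS AN EQUIVALENCE**: `|t² − 4d| ≤ |u² + 4v|·|d| ⟺ |2z| ≤ |t − zu|` (Eisenstein datum, `z ≠ 0`, `u² + 4v ≠ 0`). [cite: LabesseLanglands1979, §2 p. 8] -/
theorem valuation_sub_le_iff_valuation_two_mul_le (h2 : (2 : F) ≠ 0) {ϖ : F} (hϖ : IsUniformizingElement ϖ) {t d u v z : F}
    (hz : z ≠ 0) (hdisc : u ^ 2 + 4 * v ≠ 0) (hD : t ^ 2 - 4 * d = (u ^ 2 + 4 * v) * z ^ 2)
    (hu1 : valuation F u < 1) (hv1 : valuation F v = valuation F ϖ) :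
    valuation F (t ^ 2 - 4 * d) ≤ valuation F (u ^ 2 + 4 * v) * valuation F d ↔ valuation F (2 * z) ≤ valuation F (t - z * u) :=
  ⟨valuation_two_mul_le_valuation_sub_of_deep' h2 hϖ hz hdisc hD hu1 hv1, valuation_sub_le_of_valuation_two_mul_le h2 hϖ hz hD hu1 hv1⟩

end Valuation

/-! ## The §3 package of ★ p855546 under the sharp hypothesis -/

section Package

variable {F : Type*} [Field F] [ValuativeRel F]

/-- **THE TORUS-FORM BINDERS OF AN ELLIPTIC ELEMENT OF VERTEX TYPE, EISENSTEIN DATUM, SHARP HYPOTHESIS.**  As ★ `exists_torusForm_binders_of_eisenstein_of_deep`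
with `hdeep' : |t² − 4d| ≤ |u² + 4v|·|d|` (⟺ vertex type) in place of `hdeep` (and no `u ∈ 𝒪` binder — `|u| < 1` implies it): there are `γ₁ h ∈ GL₂(F)`, `c b ∈ F` with `c ≠ 0`, `↑(h g h⁻¹) = c·↑γ₁`,
`↑γ₁ = (1, bv; b, 1 + bu)`, `b ∈ 𝒪`, `|det γ₁| = 1`, `b·(t − zu) = 2z` — the binders `hc hconj hγ₁ (ha := one_mem) hb hγ₁det` of ★ p855257 at `a = 1`.
[cite: LabesseLanglands1979, §2 p. 8] [cite: Serre1980Trees, Ch. II §1.3] [cite: Serre1979, Ch. I §6] -/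
theorem exists_torusForm_binders_of_eisenstein_of_deep' (h2 : (2 : F) ≠ 0) {ϖ : F} (hϖ : IsUniformizingElement ϖ) {g : GL (Fin 2) F} {t d u v z : F}
    (htr : (g : Matrix (Fin 2) (Fin 2) F).trace = t) (hdet : (g : Matrix (Fin 2) (Fin 2) F).det = d) (hz : z ≠ 0) (hdisc : u ^ 2 + 4 * v ≠ 0)
    (hD : t ^ 2 - 4 * d = (u ^ 2 + 4 * v) * z ^ 2) (hu1 : valuation F u < 1) (hv1 : valuation F v = valuation F ϖ)
    (hdeep' : valuation F (t ^ 2 - 4 * d) ≤ valuation F (u ^ 2 + 4 * v) * valuation F d) :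
    ∃ (γ₁ h : GL (Fin 2) F) (c b : F), c ≠ 0 ∧ ((h * g * h⁻¹ : GL (Fin 2) F) : Matrix (Fin 2) (Fin 2) F) = c • (γ₁ : Matrix (Fin 2) (Fin 2) F) ∧
      (γ₁ : Matrix (Fin 2) (Fin 2) F) = !![1, b * v; b, 1 + b * u] ∧ b ∈ 𝒪[F] ∧ valuation F (γ₁ : Matrix (Fin 2) (Fin 2) F).det = 1 ∧ b * (t - z * u) = 2 * z := by
  have hle := valuation_two_mul_le_valuation_sub_of_deep' h2 hϖ hz hdisc hD hu1 hv1 hdeep'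
  have hx : t - z * u ≠ 0 := by
    intro h0
    rw [h0, Valuation.map_zero, le_zero_iff, Valuation.zero_iff] at hle
    exact hz ((mul_eq_zero.1 hle).resolve_left h2)
  obtain ⟨γ₁, h, hγ₁, hconj⟩ := exists_conj_eq_smul_torusFormOne h2 htr hdet hz hdisc hD hx
  have hb : 2 * z / (t - z * u) ∈ 𝒪[F] := by
    rw [Valuation.mem_integer_iff, Valuation.map_div]
    exact div_le_one_of_le₀ hle zero_le
  refine ⟨γ₁, h, (t - z * u) / 2, 2 * z / (t - z * u), div_ne_zero hx h2, hconj, hγ₁, hb, ?_, by field_simp⟩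
  rw [hγ₁]
  exact valuation_det_torusFormOne_eq_one_of_eisenstein hu1 (by rw [hv1]; exact hϖ.valuation_lt_one) hb

/-- **THE CONDUCTOR OF THE PACKAGE**: under the same hypotheses the `b` of the package has `|b|·|t − zu| = |2z|` and, in vertex type, `|b| ≤ 1`; with `|4d| = |t − zu|²`
(★ `valuation_four_mul_det_of_le`) this reads `|b|² = |4z²| ∕ |4d|·|4|∕… ` — recorded in the handy form **`|b|²·|4d| = |2z|²·|4|`**?  No: we record the clean identity
**`valuation F b ^ 2 * valuation F (4 * d) = valuation F (2 * z) ^ 2`** for `b·(t − zu) = 2z`, which the depth census (★ `F0P3cDyRamTypeOneDepthLaw`) consumes.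
[cite: LabesseLanglands1979, §2 p. 8] -/
theorem valuation_sq_mul_valuation_four_mul_det_eq (h2 : (2 : F) ≠ 0) {ϖ : F} (hϖ : IsUniformizingElement ϖ) {t d u v z b : F} (hz : z ≠ 0)
    (hD : t ^ 2 - 4 * d = (u ^ 2 + 4 * v) * z ^ 2) (hu1 : valuation F u < 1) (hv1 : valuation F v = valuation F ϖ)
    (hle : valuation F (2 * z) ≤ valuation F (t - z * u)) (hb : b * (t - z * u) = 2 * z) :
    valuation F b ^ 2 * valuation F (4 * d) = valuation F (2 * z) ^ 2 := by
  rw [valuation_four_mul_det_of_le h2 hϖ hz hD hu1 hv1 hle, ← mul_pow, ← Valuation.map_mul, hb]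

end Package

end Literature.NumberTheory.Automorphic.HermitianLatticeTree

end
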